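import Literature.AlgebraicGeometry.ModuliOfAbelianVarieties.SiegelAdelicMarkingOfAnalytification
import Literature.LinearAlgebra.FreeModule.AlternatingElementaryDivisorsUnique
import HarnessLib

/-!
# Normal-form marking: a uniformised complex abelian variety with a Frobenius basis of type `δ` is marked by
# `[J(Z), r]` through the integer frame of that basis ([Lange–Birkenhake] §8.1 Prop. 8.1.1; [Milne 2005] Thm. 6.11)

Topic `Literature/AlgebraicGeometry/ModuliOfAbelianVarieties`; namespace `Literature.AlgebraicGeometry.ModuliOfAbelianVarieties`.
Cell hodgecm-mathlib (D-0151), U-DAG brick B4 (d), residual leaf (3) «NORMAL-FORM MARKING» (B-p03 RESIDUAL c3321fae §3;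
router B-plan1 R67 (3)).  THEOREMS ONLY (no definition, no named fact, no instance, no `sorry`).  HC_CM is proved only
modulo the 7 printed citations until rung 0 closes.

SETTING.  `A` a complex abelian variety with a torus uniformisation `φ : E/Φ(ℤ^ι) → A(ℂ)` (`E = ℂ^{dim A}`, ★
`IsAnalytification`, additive), a Riemann form `η` for `Φ` (★ `ComplexTorus.IsRiemannForm`), and a FROBENIUS BASIS
`b = (λ₁, …, λ_g, μ₁, …, μ_g)` of `ℤ^ι` of type `δ` for the integer Gram form of `η` (★ `IsFrobeniusBasis (Matrix.toBilin'
(intGram Φ η)) b δ`: `E(λᵢ, μⱼ) = δᵢ δᵢⱼ`, halves isotropic — the POSITIVE convention of ★ `typeForm δ = (0 Δ; −Δ 0)` and of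
★ `latticeGram_siegelForm`).

* §1 `intCast_toBilin'_intGram` — `E(m, n) = η(Φ m, Φ n)` (the integer Gram form evaluates the `2`-form on lattice vectors);
  `transpose_mul_intGram_mul_eq_typeForm` — with `T` the integer FRAME of `b` (columns `b k`, i.e. `T = (e ↦ b)`-matrix
  ★ `(Pi.basisFun ℤ ι).toMatrix b`): `ᵗT · intGram Φ η · T = typeForm δ` (the binder `hT` of ★-parked
  `weilPairingLevel_eq_exp_pow_typeFormMod_of_mapMatrix`);
* §2 **`exists_siegelAdelicMarking_normalForm`** — there are `Z ∈ 𝔥_g` (the SIEGEL PERIOD of `(X, η, b)` in the MODULI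
  convention `(x, y) ↦ Zx + Δy` of ★ `siegelPeriodMap`, from ★ `exists_siegelPeriod_typeD` applied to the halves-swapped
  basis), the frame `T` with `ᵗT·G·T = E_δ`, a biholomorphic group isomorphism
  `h = mapMatrix T : X^δ_Z = ℂ^g/(Z, Δ)ℤ^{2g} ≃ E/Φ(ℤ^ι)` (★ `exists_homeomorph_of_baseChange`; analytic representation the
  `ℂ`-linear normal-form chart), and, for EVERY `r ∈ K_δ(1)`, a T1′ marking `m` of `A` by `[J(Z), r]` with `γ = 1` and
  torsion parametrisation `m.r v = φ (T (π_Z ṽ))` (★ (a) `exists_siegelAdelicMarking_of_addEquiv`) — exactly the `hP/hQ`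
  reading shape of the transport leaf `…_of_mapMatrix` (so the B4 (b) `hpair` clause for `m` follows from the D5 identity
  without re-framing the analytification).
-/

set_option autoImplicit false

noncomputable section

open Matrix CategoryTheory AlgebraicGeometry
open scoped Manifold ContDiff
open Literature.AlgebraicGeometry.Motives (AbelianVariety AlgPoints ComplexPoints)
open Literature.Geometry.Kaehler Literature.Geometry.Kaehler.ComplexTorus
open Literature.NumberTheory.Transcendental (IsAnalytification)
open Literature.NumberTheory.Automorphic (siegelUpperHalfSpace)
open Literature.LinearAlgebra.FreeModule (IsFrobeniusBasis)

namespace Literature.AlgebraicGeometry.ModuliOfAbelianVarieties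

open SiegelModuli

variable {g : ℕ} {δ : Fin g → ℕ}

/-! ### §1 The integer Gram form on lattice vectors; the frame of a Frobenius basis -/

section Gram

variable {ι : Type} [Fintype ι] [DecidableEq ι] {E : Type} [NormedAddCommGroup E] [NormedSpace ℂ E]
  {Φ : (ι → ℝ) ≃L[ℝ] E} {η : E [⋀^Fin 2]→L[ℝ] ℝ}

omit [DecidableEq ι] in
/-- The real coordinates of the integer frame applied to `x`: `T_ℝ x = Σ_k x_k • b_k` for `T` the matrix of columns
`b k` (`T i k = b k i`). [cite: LangeBirkenhake1992, §1.1.2] -/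
theorem map_intCast_toMatrix_mulVec (b : Module.Basis (Fin g ⊕ Fin g) ℤ (ι → ℤ)) (x : Fin g ⊕ Fin g → ℝ) :
    (((Pi.basisFun ℤ ι).toMatrix b).map (Int.cast : ℤ → ℝ)) *ᵥ x = ∑ k, x k • intVec (b k) := by
  funext i
  simp only [Matrix.mulVec, dotProduct, Matrix.map_apply, Module.Basis.toMatrix_apply, Pi.basisFun_repr,
    Finset.sum_apply, Pi.smul_apply, intVec, smul_eq_mul]
  exact Finset.sum_congr rfl fun k _ => mul_comm _ _

omit [DecidableEq ι] in
/-- The entries of the frame: `T i k = (b k) i`. [cite: LangeBirkenhake1992, §1.1.2] -/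
theorem toMatrix_basisFun_apply (b : Module.Basis (Fin g ⊕ Fin g) ℤ (ι → ℤ)) (i : ι) (k : Fin g ⊕ Fin g) :
    (Pi.basisFun ℤ ι).toMatrix b i k = b k i := by
  rw [Module.Basis.toMatrix_apply, Pi.basisFun_repr]

omit [DecidableEq ι] in
/-- Casting commutes with products of integer matrices (`Int.cast` is a ring homomorphism). [folklore] -/
private theorem map_intCast_mul {m n p : Type} [Fintype n] (P : Matrix m n ℤ) (Q : Matrix n p ℤ) :
    (P * Q).map (Int.cast : ℤ → ℝ) = P.map (Int.cast : ℤ → ℝ) * Q.map (Int.cast : ℤ → ℝ) := by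
  rw [show (Int.cast : ℤ → ℝ) = ⇑(Int.castRingHom ℝ) from rfl, Matrix.map_mul]

/-- **The integer Gram form evaluates `η` on lattice vectors**: `E(m, n) = η(Φ m, Φ n)` for `E = toBilin' (intGram Φ η)`,
`η` a Néron–Severi form (`intGram` casts to `latticeGram`, ★ `map_intGram`). [cite: Lange2023AbelianVarietiesComplex, §1.5.1] -/
theorem intCast_toBilin'_intGram (hη : IsNSForm Φ η) (m n : ι → ℤ) :
    ((Matrix.toBilin' (intGram Φ η) m n : ℤ) : ℝ) = η ![Φ (intVec m), Φ (intVec n)] := by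
  rw [Matrix.toBilin'_apply', ← dotProduct_latticeGram_mulVec, ← map_intGram Φ hη]
  simp only [dotProduct, Matrix.mulVec, Matrix.map_apply, intVec, Int.cast_sum, Int.cast_mul]

/-- The integer Gram form is alternating (`η(u, u) = 0`). [cite: Lange2023AbelianVarietiesComplex, §1.5.1] -/
theorem toBilin'_intGram_isAlt (hη : IsNSForm Φ η) : (Matrix.toBilin' (intGram Φ η)).IsAlt := by
  intro m
  have h : ((Matrix.toBilin' (intGram Φ η) m m : ℤ) : ℝ) = 0 := by
    rw [intCast_toBilin'_intGram hη, twoForm_self]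
  exact_mod_cast h

/-- **`ᵗT · intGram Φ η · T = typeForm δ`** for the frame `T` of a Frobenius basis of type `δ` (columns `b k`): the Gram
matrix of `η` on `(λ, μ)` is `(0 Δ; −Δ 0)`. [cite: LangeBirkenhake1992, §3.1 (type of a polarisation)]
[cite: GenestierNgo2020, §1.2 (symplectic basis of type D)] -/
theorem transpose_mul_intGram_mul_eq_typeForm (hη : IsNSForm Φ η) (b : Module.Basis (Fin g ⊕ Fin g) ℤ (ι → ℤ))
    (hb : IsFrobeniusBasis (Matrix.toBilin' (intGram Φ η)) b δ) :
    ((Pi.basisFun ℤ ι).toMatrix b)ᵀ * intGram Φ η * (Pi.basisFun ℤ ι).toMatrix b = typeForm δ := by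
  have hA := toBilin'_intGram_isAlt hη
  have hentry : ∀ k l, (((Pi.basisFun ℤ ι).toMatrix b)ᵀ * intGram Φ η * (Pi.basisFun ℤ ι).toMatrix b) k l =
      Matrix.toBilin' (intGram Φ η) (b k) (b l) := fun k l => by
    rw [Matrix.toBilin'_apply', Matrix.mul_assoc, Matrix.mul_apply, dotProduct]
    refine Finset.sum_congr rfl fun i _ => ?_
    rw [Matrix.transpose_apply, toMatrix_basisFun_apply, Matrix.mul_apply, Matrix.mulVec, dotProduct]
    refine congrArg _ (Finset.sum_congr rfl fun j _ => ?_)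
    rw [toMatrix_basisFun_apply]
  ext k l
  rw [hentry]
  rcases k with i | i <;> rcases l with j | j
  · rw [hb.inl_inl]; simp [typeForm]
  · rw [hb.inl_inr]; simp [typeForm, Matrix.diagonal_apply]
  · rw [hb.inr_inl hA]; by_cases hij : i = j <;> simp [typeForm, hij]
  · rw [hb.inr_inr]; simp [typeForm]

end Gram

/-! ### §2 The normal-form marking -/

/-- **NORMAL-FORM MARKING.**  Let `A` be a complex abelian variety uniformised by `φ : E/Φ(ℤ^ι) → A(ℂ)` (`E = ℂ^{dim A}`,
`dim A = g`), `η` a Riemann form for `Φ`, and `b` a Frobenius basis of `ℤ^ι` of type `δ` (`δᵢ ≥ 1`) for the integer Gram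
form of `η`.  Then there are a Siegel period `Z ∈ 𝔥_g` — in the moduli convention `(x, y) ↦ Zx + Δy` — and the integer
frame `T` of `b` (`T i k = (b k) i`) such that `ᵗT · intGram Φ η · T = E_δ`, the base change `mapMatrix T` is a
biholomorphic group isomorphism `h : X^δ_Z = ℂ^g/(Z, Δ)ℤ^{2g} ≃ E/Φ(ℤ^ι)`, and for EVERY `r ∈ K_δ(1)` there is a T1′ marking
`m` of `A` by `[J(Z), r]` with `γ = 1` whose torsion parametrisation is `v ↦ φ(T(π_Z ṽ))` ([LangeBirkenhake1992] §8.1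
Prop. 8.1.1 «the period matrix with respect to a symplectic basis is `(Z, D)`, `Z ∈ 𝔥_g`»; [Milne2005ShimuraVarieties]
Thm. 6.11, proof: «choose an isomorphism `a : H₁(A, ℤ) → V(ℤ)` …»).
[cite: LangeBirkenhake1992, §8.1 Prop. 8.1.1 and §1.1.2] [cite: Milne2005ShimuraVarieties, §6 Thm. 6.11 pp. 74–75]
[cite: Lange2023AbelianVarietiesComplex, §3.1.1 Prop. 3.1.1 and Thm. 3.1.2] -/
theorem exists_siegelAdelicMarking_normalForm (A : AbelianVariety ℂ) (hg : A.dim = g) (hδ : ∀ i, 0 < δ i)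
    {ι : Type} [Fintype ι] [DecidableEq ι] {Φ : (ι → ℝ) ≃L[ℝ] (Fin A.dim → ℂ)}
    (φ : ComplexTorus Φ → A.Points ℂ) (hφ : IsAnalytification (Fin A.dim → ℂ) A.X A.dim φ)
    (hadd : ∀ x y, φ (x + y) = φ x * φ y)
    {η : (Fin A.dim → ℂ) [⋀^Fin 2]→L[ℝ] ℝ} (hη : IsRiemannForm Φ η)
    (b : Module.Basis (Fin g ⊕ Fin g) ℤ (ι → ℤ)) (hb : IsFrobeniusBasis (Matrix.toBilin' (intGram Φ η)) b δ) :
    ∃ (Z : Matrix (Fin g) (Fin g) ℂ) (hZ : Z ∈ siegelUpperHalfSpace g) (T : Matrix ι (Fin g ⊕ Fin g) ℤ),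
      (∀ k i, T i k = b k i) ∧
      Tᵀ * intGram Φ η * T = typeForm δ ∧
      (∃ h : ComplexTorus (siegelPeriodEquiv hδ hZ) ≃+ ComplexTorus Φ,
        (∀ x, h x = mapMatrix (siegelPeriodEquiv hδ hZ) Φ T x) ∧
        ContMDiff 𝓘(ℂ, Fin g → ℂ) 𝓘(ℂ, Fin A.dim → ℂ) ω h ∧
        ContMDiff 𝓘(ℂ, Fin A.dim → ℂ) 𝓘(ℂ, Fin g → ℂ) ω h.symm) ∧
      ∀ (r : gspFinAdelic δ), r ∈ principalLevelSubgroup δ 1 →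
        ∃ m : SiegelAdelicMarking ⟨jOfSiegel δ Z, SiegelComplexRecordSystem.jOfSiegel_mem_C0pm hδ hZ⟩ r A,
          m.γ = 1 ∧ ∀ v : Fin g ⊕ Fin g → ℚ,
            m.r v = φ (mapMatrix (siegelPeriodEquiv hδ hZ) Φ T
              (ComplexTorus.proj (siegelPeriodEquiv hδ hZ) fun i => (v i : ℝ))) := by
  classical
  have hNS : IsNSForm Φ η := hη.isNSForm
  -- the `η`-clauses of the Frobenius basis
  have hEv : ∀ m n, ((Matrix.toBilin' (intGram Φ η) m n : ℤ) : ℝ) = η ![Φ (intVec m), Φ (intVec n)] :=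
    intCast_toBilin'_intGram hNS
  have h₁₁ : ∀ i j, η ![Φ (intVec (b (Sum.inl i))), Φ (intVec (b (Sum.inl j)))] = 0 := fun i j => by
    rw [← hEv, hb.inl_inl, Int.cast_zero]
  have h₂₂ : ∀ i j, η ![Φ (intVec (b (Sum.inr i))), Φ (intVec (b (Sum.inr j)))] = 0 := fun i j => by
    rw [← hEv, hb.inr_inr, Int.cast_zero]
  have h₁₂ : ∀ i j, η ![Φ (intVec (b (Sum.inl i))), Φ (intVec (b (Sum.inr j)))] =
      if i = j then (δ i : ℝ) else 0 := fun i j => by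
    rw [← hEv, hb.inl_inr]; split_ifs <;> simp
  -- the halves-swapped basis `b'` feeds ★ `exists_siegelPeriod_typeD` (its `(D, Ω)` convention)
  set b' : Module.Basis (Fin g ⊕ Fin g) ℤ (ι → ℤ) := b.reindex (Equiv.sumComm (Fin g) (Fin g)) with hb'
  have hb'apply : ∀ k, b' k = b (Sum.swap k) := fun k => by
    rw [hb', Module.Basis.reindex_apply, Equiv.sumComm_symm, Equiv.sumComm_apply]
  have h₁₁' : ∀ i j, η ![Φ (intVec (b' (Sum.inl i))), Φ (intVec (b' (Sum.inl j)))] = 0 := fun i j => by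
    rw [hb'apply, hb'apply]; exact h₂₂ i j
  have h₂₂' : ∀ i j, η ![Φ (intVec (b' (Sum.inr i))), Φ (intVec (b' (Sum.inr j)))] = 0 := fun i j => by
    rw [hb'apply, hb'apply]; exact h₁₁ i j
  have h₂₁' : ∀ i j, η ![Φ (intVec (b' (Sum.inr i))), Φ (intVec (b' (Sum.inl j)))] =
      if i = j then (δ i : ℝ) else 0 := fun i j => by
    rw [hb'apply, hb'apply]; exact h₁₂ i j
  obtain ⟨Ψ, Ω, Φ', hΨI, hΩsym, hΩpos, hΦ'v, hΦ'P⟩ := exists_siegelPeriod_typeD Φ hη b' δ hδ h₁₁' h₂₂' h₂₁'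
  have hZ : Ω ∈ siegelUpperHalfSpace g := SiegelModuliDatum.mem_siegelUpperHalfSpace_of_symm_posDef hΩsym hΩpos
  -- the frame `T` of `b` and its inverse
  set T : Matrix ι (Fin g ⊕ Fin g) ℤ := (Pi.basisFun ℤ ι).toMatrix b with hT
  set T' : Matrix (Fin g ⊕ Fin g) ι ℤ := b.toMatrix (Pi.basisFun ℤ ι) with hT'
  have hTT' : T * T' = 1 := (Pi.basisFun ℤ ι).toMatrix_mul_toMatrix_flip b
  have hT'T : T' * T = 1 := b.toMatrix_mul_toMatrix_flip (Pi.basisFun ℤ ι)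
  -- frames of `b'`
  have hP'Q' : b'.toMatrix (Pi.basisFun ℤ ι) * (Pi.basisFun ℤ ι).toMatrix b' = 1 :=
    b'.toMatrix_mul_toMatrix_flip (Pi.basisFun ℤ ι)
  -- `Φ (Q'_ℝ w) = Ψ⁻¹ (Φ' w)` (invert `hΦ'P`)
  have hΦQ' : ∀ w, Φ ((((Pi.basisFun ℤ ι).toMatrix b').map (Int.cast : ℤ → ℝ)) *ᵥ w) = Ψ.symm (Φ' w) := fun w => by
    have h := hΦ'P ((((Pi.basisFun ℤ ι).toMatrix b').map (Int.cast : ℤ → ℝ)) *ᵥ w)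
    rw [Matrix.mulVec_mulVec, ← map_intCast_mul, hP'Q', Matrix.map_one _ Int.cast_zero Int.cast_one,
      Matrix.one_mulVec] at h
    rw [h, ContinuousLinearEquiv.symm_apply_apply]
  -- `T_ℝ v = Q'_ℝ (v ∘ swap)` (both are `Σ_k v_k • b_k`)
  have hTswap : ∀ v : Fin g ⊕ Fin g → ℝ, (T.map (Int.cast : ℤ → ℝ)) *ᵥ v =
      (((Pi.basisFun ℤ ι).toMatrix b').map (Int.cast : ℤ → ℝ)) *ᵥ (fun k => v (Sum.swap k)) := fun v => by
    rw [hT, map_intCast_toMatrix_mulVec, map_intCast_toMatrix_mulVec]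
    simp only [hb'apply]
    exact (Equiv.sum_comp (Equiv.sumComm (Fin g) (Fin g)) (fun k => v k • intVec (b k))).symm
  -- `Φ' (v ∘ swap) = Φ_Z v` (the two block orders)
  have hswap : ∀ v : Fin g ⊕ Fin g → ℝ, Φ' (fun k => v (Sum.swap k)) = siegelPeriodEquiv hδ hZ v := fun v => by
    funext i
    rw [hΦ'v, siegelPeriodEquiv_apply, siegelPeriodMap_apply]
    simp only [Sum.swap_inl, Sum.swap_inr]
    ring
  -- the analytic representation of `mapMatrix T : X^δ_Z → X` is `Ψ⁻¹` (`ℂ`-linear)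
  have hΦT : ∀ v, Φ ((T.map (Int.cast : ℤ → ℝ)) *ᵥ v) = Ψ.symm (siegelPeriodEquiv hδ hZ v) := fun v => by
    rw [hTswap, hΦQ', hswap]
  have hΨsymmI : ∀ u, Ψ.symm (Complex.I • u) = Complex.I • Ψ.symm u := fun u =>
    Ψ.injective (by rw [hΨI, Ψ.apply_symm_apply, Ψ.apply_symm_apply])
  obtain ⟨e, he, hesymm, headd, hhol, hholsymm⟩ :=
    exists_homeomorph_of_baseChange (siegelPeriodEquiv hδ hZ) Φ T T' hTT' hT'T Ψ.symm hΨsymmI hΦT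
  -- the additive biholomorphism `h = mapMatrix T`
  let h : ComplexTorus (siegelPeriodEquiv hδ hZ) ≃+ ComplexTorus Φ :=
    { toFun := e, invFun := e.symm, left_inv := e.symm_apply_apply, right_inv := e.apply_symm_apply,
      map_add' := headd }
  have hh : ContMDiff 𝓘(ℂ, Fin g → ℂ) 𝓘(ℂ, Fin A.dim → ℂ) ω h := hhol
  have hh' : ContMDiff 𝓘(ℂ, Fin A.dim → ℂ) 𝓘(ℂ, Fin g → ℂ) ω h.symm := hholsymm
  refine ⟨Ω, hZ, T, fun k i => toMatrix_basisFun_apply b i k, ?_, ⟨h, fun x => he x, hh, hh'⟩, fun r hr => ?_⟩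
  · rw [hT]; exact transpose_mul_intGram_mul_eq_typeForm hNS b hb
  · obtain ⟨m, hγ, -, hr'⟩ := exists_siegelAdelicMarking_of_addEquiv A φ hφ hadd hg hδ hZ h hh hh' hr
    exact ⟨m, hγ, fun v => by rw [hr' v]; exact congrArg φ (he _)⟩

end Literature.AlgebraicGeometry.ModuliOfAbelianVarieties

end
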